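import Summits.QuantumFields.YangMills.Theorems.BalabanLadderNTCanonicalKernel
import Summits.QuantumFields.YangMills.Theorems.BalabanLadderNTReferenceTorusTwoPoint
import HarnessLib

/-!
# Crux `NT` (stmt-QuantumFields-19353), stub `stub_refpkgT : RefPkgT`: CANONICAL ENVELOPES III — clause 4 of the registered
# package is a PLAIN floor beating ONE intrinsic number `M₂ᶜᵃⁿ(v) = 2C₁²‖v‖₁²/κ⁸ + (C₂/κ⁴)∫∫|θv||v|/‖·‖⁴`

Helper file (`--supports stmt-QuantumFields-19353`) of the fleet lead prover of crux `NT` (unit `ym-spine-19353-p1`,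
GEN 12); sequel of `…NTCanonicalKernel` (`margin₂_tendsto_canonical`) and of g4's `…NTReferenceTorusTwoPoint`
(`lowerBounds_fst_of_torusReference`).  Hypothesis-free, general compact `G`, any `r`.

* **`clause₄_of_canonicalFloor`** — if on reference tori `L₀ β` covering the support the witness `v` (positive time, ball of
  radius `σ`) clears the CANONICAL number, `ε + M₂ᶜᵃⁿ(v) ≤ Q2_{β,L₀β,aβ}(θv, v)` (`ε > 0`, `β ≥ β₅`), then the REGISTERED
  clause-4 floor-with-margin holds with `ε/2` for all large `β` (the lattice margin tends to `M₂ᶜᵃⁿ`);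
* **`lowerBounds_fst_of_torusReference_canonical`** — E1-osc + E2-osc + that canonical floor on ONE torus per coupling ⇒
  clause (i) of `LowerBounds G r a` on EVERY large torus (composition with g4's transfer).

So, for the two-point half, `stub_refpkgT` = {E1/E2-osc} + {ONE positive-time witness whose reflection-paired two-point function
exceeds `2C₁²‖v‖₁²/κ⁸ + (C₂/κ⁴)∫∫|θv(X)||v(Y)|/‖X−Y‖⁴ dX dY` by a fixed `ε` on one torus per coupling} — every lattice envelope,
unit and transfer constant is discharged in the tree (g11 gave the version with the sup-norm numbers `K = M(2σ+3)⁴`).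

HONEST FRAMING.  Limits and bookkeeping over tree theorems; no floor is proved; not AF, not NT, not the seam, not the gap; not Clay.
-/

set_option autoImplicit false

noncomputable section

open scoped SchwartzMap
open MeasureTheory Filter Topology
open Literature.MathematicalPhysics.QuantumFieldTheory Literature.MathematicalPhysics.QuantumLattice
open Literature.Probability.LatticeModels
open Summit.QuantumFields.YangMills.Cruxes.OSLegsFromFemtoAndGap.DlrCollarTransfer
open Summit.QuantumFields.YangMills.Cruxes.NT.Reference
  (exists_timeGap_of_tsupport_subset lowerBounds_fst_of_torusReference)

namespace Summit.QuantumFields.YangMills.Cruxes.NT.CeilingPrice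

section Package

variable (G : Type) [Group G] [TopologicalSpace G] [IsTopologicalGroup G] [CompactSpace G]
  [MeasurableSpace G] [BorelSpace G] (r : LatticeRep G)

/-- **A canonical floor gives the registered clause-4 floor-with-margin (with `ε/2`).**  Let `a > 0`, `a → 0`; `v` a
positive-time witness supported in the ball of radius `σ ≥ 0`; reference tori `L₀ β` with `σ ≤ a β·L₀ β` for `β ≥ β₅`; and
`ε + (2C₁²‖v‖₁²/κ⁸ + (C₂/κ⁴)∫∫|θv||v|/‖·‖⁴) ≤ Q2_{β,L₀β,aβ}(θv, v)` for `β ≥ β₅`, `ε > 0`.  Then for all large `β` the registered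
lattice margin fits under `Q2 − ε/2`. [folklore] -/
theorem clause₄_of_canonicalFloor (a : ℝ → ℝ) (ha : ∀ β, 0 < a β) (ha0 : Tendsto a atTop (𝓝 0)) {C₁ C₂ κ σ : ℝ}
    (hσ : 0 ≤ σ) {v : 𝓢(EuclideanSpace ℝ (Fin 4), ℝ)}
    (hv : tsupport (v : EuclideanSpace ℝ (Fin 4) → ℝ) ⊆ {y | 0 < y 0})
    (hvσ : tsupport (v : EuclideanSpace ℝ (Fin 4) → ℝ) ⊆ Metric.closedBall 0 σ) {ε β₅ : ℝ} {L₀ : ℝ → ℕ} (hε : 0 < ε)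
    (hcov : ∀ β : ℝ, β₅ ≤ β → σ ≤ a β * L₀ β)
    (hfloor : ∀ β : ℝ, β₅ ≤ β →
      ε + (2 * C₁ ^ 2 * (∫ y, |v y|) ^ 2 / κ ^ 8 +
        C₂ / κ ^ 4 * ∫ p : Fin 2 → EuclideanSpace ℝ (Fin 4), |thetaTest 4 v (p 0)| * |v (p 1)| / ‖p 1 - p 0‖ ^ 4) ≤
        Q2 G r β (L₀ β) (a β) (thetaTest 4 v) v) :
    ∃ β₅' : ℝ, β₅ ≤ β₅' ∧ ∀ β : ℝ, β₅' ≤ β →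
      ε / 2 + 2 * (C₁ * (a β / κ) ^ 4 * ∑ x ∈ box 4 (L₀ β), |thetaTest 4 v (a β • siteToE x)|) *
            (C₁ * (a β / κ) ^ 4 * ∑ y ∈ box 4 (L₀ β), |v (a β • siteToE y)|) +
          C₂ * (a β / κ) ^ 4 * ∑ x ∈ box 4 (L₀ β), ∑ y ∈ box 4 (L₀ β),
            |thetaTest 4 v (a β • siteToE x)| * |v (a β • siteToE y)| / (1 + ‖siteToE (y - x)‖) ^ 4 ≤
        Q2 G r β (L₀ β) (a β) (thetaTest 4 v) v := by
  obtain ⟨δ, hδ, hvδ⟩ := exists_timeGap_of_tsupport_subset hv hvσ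
  have hL : ∀ᶠ β in atTop, σ ≤ a β * L₀ β := eventually_atTop.2 ⟨β₅, hcov⟩
  have hlim := margin₂_tendsto_canonical hδ hσ hvδ hvσ a L₀ ha ha0 hL C₁ C₂ κ
  set M := 2 * C₁ ^ 2 * (∫ y, |v y|) ^ 2 / κ ^ 8 +
    C₂ / κ ^ 4 * ∫ p : Fin 2 → EuclideanSpace ℝ (Fin 4), |thetaTest 4 v (p 0)| * |v (p 1)| / ‖p 1 - p 0‖ ^ 4 with hM
  have hev : ∀ᶠ β in atTop,
      2 * (C₁ * (a β / κ) ^ 4 * ∑ x ∈ box 4 (L₀ β), |thetaTest 4 v (a β • siteToE x)|) *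
            (C₁ * (a β / κ) ^ 4 * ∑ y ∈ box 4 (L₀ β), |v (a β • siteToE y)|) +
          C₂ * (a β / κ) ^ 4 * ∑ x ∈ box 4 (L₀ β), ∑ y ∈ box 4 (L₀ β),
            |thetaTest 4 v (a β • siteToE x)| * |v (a β • siteToE y)| / (1 + ‖siteToE (y - x)‖) ^ 4 < M + ε / 2 :=
    (tendsto_order.1 hlim).2 (M + ε / 2) (by linarith)
  obtain ⟨βc, hβc⟩ := eventually_atTop.1 hev
  refine ⟨max β₅ βc, le_max_left _ _, fun β hβ => ?_⟩
  have hβ5 : β₅ ≤ β := le_trans (le_max_left _ _) hβ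
  have hβc' : βc ≤ β := le_trans (le_max_right _ _) hβ
  have h1 := hβc β hβc'
  have h2 := hfloor β hβ5
  linarith

/-- **Clause (i) of `LowerBounds` from a periodic reference with the CANONICAL margin.**  A unit map `a` (`0 < a`, `a → 0`);
`C₁, C₂ ≥ 0`, femto scale `ℓ`, support radius `σ > 0`, collar `κ > 0` with `2(σ+κ) < ℓ`; (E1-osc), (E2-osc) as registered;
and ONE positive-time `v` supported in the ball of radius `σ`, `ε > 0`, reference tori `2L₀(β)+1` with
`a β · L₀(β) ≥ σ + κ + 1` on which `ε + M₂ᶜᵃⁿ(v) ≤ Q2_{β,L₀(β),aβ}(θv, v)`,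
`M₂ᶜᵃⁿ(v) = 2C₁²‖v‖₁²/κ⁸ + (C₂/κ⁴)∫∫|θv(p₀)||v(p₁)|/‖p₁−p₀‖⁴`.  Then clause (i) of `LowerBounds G r a` holds (with `ε/2`) on
EVERY large torus. [folklore] -/
theorem lowerBounds_fst_of_torusReference_canonical (a : ℝ → ℝ) (ha₀ : ∀ β, 0 < a β) (ha : Tendsto a atTop (𝓝 0))
    {C₁ C₂ ℓ σ κ : ℝ} (hC₁ : 0 ≤ C₁) (hC₂ : 0 ≤ C₂) (hσ : 0 < σ) (hκ : 0 < κ) (hℓ : 2 * (σ + κ) < ℓ)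
    (hE1 : ∃ β₁ : ℝ, ∀ β : ℝ, β₁ ≤ β → ∀ (c : Fin 4 → ℤ) (b : ℕ), (b : ℝ) * a β ≤ ℓ →
      ∀ (η η' : LGConfig 4 G) (x : Fin 4 → ℤ), 1 ≤ depth c b x →
        |kerE G r β c b η (dens G r x) - kerE G r β c b η' (dens G r x)| ≤ C₁ / (depth c b x : ℝ) ^ 4)
    (hE2 : ∃ β₂ : ℝ, ∀ β : ℝ, β₂ ≤ β → ∀ (c : Fin 4 → ℤ) (b : ℕ), (b : ℝ) * a β ≤ ℓ →
      ∀ (η η' : LGConfig 4 G) (x y : Fin 4 → ℤ), 1 ≤ depth c b x → 1 ≤ depth c b y →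
        |kerCov G r β c b η (dens G r x) (dens G r y) - kerCov G r β c b η' (dens G r x) (dens G r y)| ≤
          C₂ / ((min (depth c b x) (depth c b y) : ℕ) : ℝ) ^ 4 / (1 + ‖siteToE (y - x)‖) ^ 4)
    (hR2 : ∃ (v : 𝓢(EuclideanSpace ℝ (Fin 4), ℝ)) (ε β₅ : ℝ) (L₀ : ℝ → ℕ),
      tsupport (v : EuclideanSpace ℝ (Fin 4) → ℝ) ⊆ {y | 0 < y 0} ∧
      tsupport (v : EuclideanSpace ℝ (Fin 4) → ℝ) ⊆ Metric.closedBall 0 σ ∧ 0 < ε ∧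
      ∀ β : ℝ, β₅ ≤ β → σ + κ + 1 ≤ a β * L₀ β ∧
        ε + (2 * C₁ ^ 2 * (∫ y, |v y|) ^ 2 / κ ^ 8 +
          C₂ / κ ^ 4 * ∫ p : Fin 2 → EuclideanSpace ℝ (Fin 4), |thetaTest 4 v (p 0)| * |v (p 1)| / ‖p 1 - p 0‖ ^ 4) ≤
          Q2 G r β (L₀ β) (a β) (thetaTest 4 v) v) :
    ∃ (v : 𝓢(EuclideanSpace ℝ (Fin 4), ℝ)) (ε β₅ Λ₅ : ℝ),
      tsupport (v : EuclideanSpace ℝ (Fin 4) → ℝ) ⊆ {y : EuclideanSpace ℝ (Fin 4) | 0 < y 0} ∧ 0 < ε ∧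
      ∀ β : ℝ, β₅ ≤ β → ∀ L : ℕ, Λ₅ ≤ a β * L → ε ≤ Q2 G r β L (a β) (thetaTest 4 v) v := by
  obtain ⟨v, ε, β₅, L₀, hv, hvσ, hε, HR⟩ := hR2
  have hcov : ∀ β : ℝ, β₅ ≤ β → σ ≤ a β * L₀ β := fun β hβ => by linarith [(HR β hβ).1]
  obtain ⟨β₅', hβ₅', H4⟩ :=
    clause₄_of_canonicalFloor G r a ha₀ ha hσ.le hv hvσ hε hcov (fun β hβ => (HR β hβ).2)
  exact lowerBounds_fst_of_torusReference G r a ha₀ ha hC₁ hC₂ hσ hκ hℓ hE1 hE2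
    ⟨v, ε / 2, β₅', L₀, hv, hvσ, by linarith, fun β hβ => ⟨(HR β (hβ₅'.trans hβ)).1, H4 β hβ⟩⟩

end Package

end Summit.QuantumFields.YangMills.Cruxes.NT.CeilingPrice

end
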